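import Summits.Ventures.CertifiedArithmetic.LowPrec.GemmLevel2TWord
import Summits.Ventures.CertifiedArithmetic.LowPrec.GemmFirstRegimeLawRows
import HarnessLib

/-!
# GEMM worst case LXVIII-b — THE LEVEL-`2T` FAMILY OF `Π(E2M1,E2M1)` AT EVERY PRECISION: the end
# of the first regime, bfloat16 and binary16

HONEST FRAMING (venture CertifiedArithmetic / cell `pub-lowprec`): certified error envelopes and
provably optimal rounding/accumulation schemes for low-precision formats under stated cost models;
every table by two implementations; no hardware or vendor claims.

`gemm.tex` Prop. p:level2T.  For products of two E2M1 values (quarter units: `G = 2`, `M = 144`,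
`m₀ = 9`) accumulated sequentially in a `p`-bit format (`T = 2^p = 2^(manBits+1)` in quarter units,
`n₀ = j₀ + 1` exact letters, `144 j₀ + 9 < T ≤ 144(j₀+1) + 9`), the climbing word of file LXVIII-a

  `¾, B/4, 36^{×j₀}, ¾^{×c}, ½, -½, -½, …`,   `3 + B + 144 j₀ = T + v`,  `4c = T + 3 - v`,

gives, with `k = c + 2 + r` letters after the exact range (`le_worstP_level2T`),

  `W_p(n₀ + k) ≥ (8k - T + v - 7) / (8k + 5T + 3v - 5)`      for every `4k ≥ T + 11 - v`,

where `(B/4, v) = (36, 35), (36, 19), (24, 19), (16, 3), (4, 3), (8, 3)` for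
`p ≡ 2, 1, 3, 0, 4, 5 (mod 6)`.  Consequences, every `p ≥ 8`:
* THE FIRST REGIME ENDS AT `k = 2^(p-1)` (up to at most four lengths): the closed form
  `max(k/(B_p+k), (k-1)/(T+k-1))` of `worstP_firstRegimeLaw_one/_two` (`p ≡ 1, 2 (mod 6)`) is
  STRICTLY BELOW `W_p(n₀+k)` for every `k ≥ 2^(p-1) + 2` (`firstRegimeLaw_one_fails`,
  `firstRegimeLaw_two_fails`; at `k = 2^(p-1) + 1` the family equals the closed form's value `1/3`),
  and the law `k/(T+k) = ku/(1+ku)` of `worstP_firstRegime` (`p ≡ 0, 3, 4, 5`) is strictly below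
  `W_p(n₀+k)` for every `k ≥ 2^(p-1) + 5` (`firstRegime_fails_zero/_three/_four/_five`).
* bfloat16 (`p = 8`, `v = 35`, `j₀ = 1`): the family is the level-7 family (a) of file LIII,
  `(2n-61)/(2n+341)` (`le_worstP_BFloat16_level2T`; consistency with `TieChain.bf16_l7a_ratio`).
* binary16 (`p = 11 ≡ 5`, `v = 3`, `j₀ = 14`): `W_11(n) ≥ (2n-543)/(2n+2531)` for every `n ≥ 529`
  (`le_worstP_Binary16_level2T`), EQUAL to the certified `W_11(1200) = 1857/4931` of
  `GEMM-BOUNDS.md` §4 (whose maximiser is this word); hence Prop. p:fp16's closed form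
  `(n-15)/(2033+n)` (kernel-exact for `16 ≤ n ≤ 1039`, `worstP_Binary16_law`) FAILS for every
  `n ≥ 1044` (`worstP_Binary16_law_fails`).  `1040 ≤ n ≤ 1043` is decided by neither theorem.

No numerics; `decide`/`norm_num` only on format constants and alphabet membership.

References: [IEEE7542019, §4.3.1], [BoldoEtAl2023, Thm 4.5], [LangeRump2019] (the bound
`ku/(1+ku)` without restriction on `n` holds for recursive summation of REPRESENTABLE summands; here
the summands are exact products and the accumulation is the model of gemm.tex §Model — the family
shows where the first-regime VALUE stops being the worst case, not a violation of that theorem),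
cell documents `GEMM-BOUNDS.md` §4 and `gemm.tex` Props. p:fp16, p:sandwich, p:level2T.
-/

namespace Summit.Ventures.CertifiedArithmetic.LowPrec.Gemm

open Literature.ComputerArithmetic.FloatingPoint
open Literature.ComputerArithmetic.FloatingPoint.MiniFloat
open Finset

/-! ### The climbing word over `Π(E2M1,E2M1)` -/

/-- Grid facts `(2, 144, 9)` of a natural quarter-unit letter of `Π(E2M1,E2M1)`. [cell] -/
theorem e2m1_natFacts {X : ℕ} (h : ((X : ℕ) : ℚ) / 4 ∈ piE2M1) : X ≤ 144 ∧ (X % 2 = 0 ∨ X ≤ 9) := by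
  have h' : ((X : ℕ) : ℚ) / 2 ^ 2 ∈ piE2M1 := by norm_num; exact h
  exact facts_nat_of (G := 2) (piE2M1_grid _ h')

/-- The climbing word `A/4, B/4, 36^{×j}, C/4, ¾^{×c}, ½, -½, …` is a word over `Π(E2M1,E2M1)` when
`A/4, B/4, C/4` are letters. [cell] -/
theorem cw_mem {j A B C c : ℕ} (hA : ((A : ℕ) : ℚ) / 4 ∈ piE2M1) (hB : ((B : ℕ) : ℚ) / 4 ∈ piE2M1)
    (hC : ((C : ℕ) : ℚ) / 4 ∈ piE2M1) (i : ℕ) : cw 2 144 j A B C c i ∈ piE2M1 := by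
  have e4 : (2 : ℚ) ^ 2 = 4 := by norm_num
  refine cw_forall (P := fun q : ℚ => q ∈ piE2M1) ?_ ?_ ?_ ?_ ?_ ?_ ?_ i
  · rw [e4]; exact hA
  · rw [e4]; exact hB
  · norm_num [piE2M1]
  · rw [e4]; exact hC
  · norm_num [piE2M1]
  · norm_num [piE2M1]
  · norm_num [piE2M1]

variable {φ : Format} {E : ℕ}

section Regime

variable (hq : φ.qexp ≤ -2) (hR : (2 : ℚ) ^ (φ.manBits + E + 3) ≤ φ.maxRat)
include hq hR

/-- THE LEVEL-`2T` ROW, every precision: with letters `A/4, B/4`, `144 j₀ + 9 < T`,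
`A + B + 144 j₀ = T + v`, `v ≡ 3 (mod 4)`, `v < T`: for every `k` with `4k + v ≥ T + 11`,
`(8k - T + v - 7)/(8k + 5T + 3v - 5) ≤ W_φ(j₀ + k)` (index `m = j₀ + k`, i.e. `n₀ + k` letters) —
the word `A/4, B/4, 36^{×j₀}, ¾^{×c}, ½, (-½)^{×r}`, `4c = T + 3 - v`, `k = c + 2 + r`.
[cell, gemm.tex Prop. p:level2T] -/
theorem le_worstP_level2T {j0 A B v k : ℕ} (hA : ((A : ℕ) : ℚ) / 4 ∈ piE2M1)
    (hB : ((B : ℕ) : ℚ) / 4 ∈ piE2M1) (hT : 144 * j0 + 9 < 2 ^ (φ.manBits + 1)) (hj0 : 1 ≤ j0)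
    (hV : A + B + 144 * j0 = 2 ^ (φ.manBits + 1) + v) (hv4 : v % 4 = 3)
    (hv : v < 2 ^ (φ.manBits + 1)) (hk : 2 ^ (φ.manBits + 1) + 11 ≤ 4 * k + v) :
    ((8 * k : ℚ) - 2 ^ (φ.manBits + 1) + v - 7) / (8 * k + 5 * 2 ^ (φ.manBits + 1) + 3 * v - 5)
      ≤ worstRelErrE2M1 φ (j0 + k) := by
  obtain ⟨j, rfl⟩ : ∃ j, j0 = j + 1 := ⟨j0 - 1, by omega⟩
  have hmb : 1 ≤ φ.manBits := one_le_manBits_of (M := 144) (m0 := 9) (j := j) (by norm_num)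
    (by norm_num) hT
  have h4T : 4 ∣ 2 ^ (φ.manBits + 1) := ⟨2 ^ (φ.manBits - 1), by
    rw [show (4 : ℕ) = 2 ^ 2 by norm_num, ← pow_add]; congr 1; omega⟩
  obtain ⟨c, hc⟩ : ∃ c, 2 ^ (φ.manBits + 1) + 3 = v + 4 * c :=
    ⟨(2 ^ (φ.manBits + 1) + 3 - v) / 4, by omega⟩
  obtain ⟨r, hr⟩ : ∃ r, k = c + 2 + r := ⟨k - (c + 2), by omega⟩
  have hC : 144 ≤ 144 ∧ (144 % 2 = 0 ∨ 144 ≤ 9) := ⟨le_rfl, Or.inl (by decide)⟩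
  have h := relErr_cw (G := 2) (M := 144) (m0 := 9) (E := E) (c := c) hq hR (by norm_num)
    (by omega) (by norm_num) (by norm_num) (V := 2 ^ (φ.manBits + 1) + v) (e2m1_natFacts hA)
    (e2m1_natFacts hB) hC hT (by omega) (Nat.le_add_right _ _) (by omega) (by omega) r
  rw [show j + 1 + k = j + 3 + c + r by omega]
  have hr' : (k : ℚ) = c + 2 + r := by exact_mod_cast hr
  have hc' : (2 : ℚ) ^ (φ.manBits + 1) + 3 = v + 4 * c := by exact_mod_cast hc
  have en : (8 * k : ℚ) - 2 ^ (φ.manBits + 1) + v - 7 = 4 * ((c + 3 + 2 * r : ℕ) : ℚ) := by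
    push_cast; linear_combination 8 * hr' - hc'
  have ed : (8 * k : ℚ) + 5 * 2 ^ (φ.manBits + 1) + 3 * v - 5
      = 4 * ((2 ^ (φ.manBits + 1) + v + 3 * c + 2 + 2 * r : ℕ) : ℚ) := by
    push_cast; linear_combination 8 * hr' + hc'
  calc _ = relErr φ (cw 2 144 j A B 144 c) (j + 3 + c + r) := by
        rw [h, en, ed, mul_div_mul_left _ _ (by norm_num : (4 : ℚ) ≠ 0)]
    _ ≤ _ := relErr_le_worstP φ _ (cw_mem hA hB (by norm_num [piE2M1])) _

end Regime

/-! ### The two rational comparisons (pure algebra) -/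

/-- For `T ≥ 256`, `2k ≥ T + 10` and `v ∈ {3, 19}`: `k/(T+k) < (8k-T+v-7)/(8k+5T+3v-5)`
(cross-multiplied: `(2k-T-10)(T-v-1) + 2T - 10v - 10 > 0`). [cell] -/
theorem law_lt_level2T_ratio {T k v : ℚ} (hT : 256 ≤ T) (hk : T + 10 ≤ 2 * k)
    (hv : v = 3 ∨ v = 19) :
    k / (T + k) < (8 * k - T + v - 7) / (8 * k + 5 * T + 3 * v - 5) := by
  rcases hv with rfl | rfl
  · rw [div_lt_div_iff₀ (by linarith) (by linarith)]
    nlinarith [mul_nonneg (by linarith : (0 : ℚ) ≤ 2 * k - T - 10) (by linarith : (0 : ℚ) ≤ T - 4)]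
  · rw [div_lt_div_iff₀ (by linarith) (by linarith)]
    nlinarith [mul_nonneg (by linarith : (0 : ℚ) ≤ 2 * k - T - 10) (by linarith : (0 : ℚ) ≤ T - 20)]

/-- For `T ≥ 256`, `2k ≥ T + 4` and `(b, v) ∈ {(16, 19), (32, 35)}`:
`max(k/(T+b+k), (k-1)/(T+k-1)) < (8k-T+v-7)/(8k+5T+3v-5)` (cross-multiplied:
`(2k-T-4)(T+3v-13) + …  > 0` and `(2k-T-2)(T-v-1) > 0`). [cell] -/
theorem lawMax_lt_level2T_ratio {T k b v : ℚ} (hT : 256 ≤ T) (hk : T + 4 ≤ 2 * k)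
    (hbv : (b = 16 ∧ v = 19) ∨ (b = 32 ∧ v = 35)) :
    max (k / (T + b + k)) ((k - 1) / (T + k - 1))
      < (8 * k - T + v - 7) / (8 * k + 5 * T + 3 * v - 5) := by
  rcases hbv with ⟨rfl, rfl⟩ | ⟨rfl, rfl⟩
  · refine max_lt ?_ ?_
    · rw [div_lt_div_iff₀ (by linarith) (by linarith)]
      nlinarith [mul_nonneg (by linarith : (0 : ℚ) ≤ 2 * k - T - 4) (by linarith : (0 : ℚ) ≤ T + 44)]
    · rw [div_lt_div_iff₀ (by linarith) (by linarith)]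
      nlinarith [mul_pos (by linarith : (0 : ℚ) < 2 * k - T - 2) (by linarith : (0 : ℚ) < T - 20)]
  · refine max_lt ?_ ?_
    · rw [div_lt_div_iff₀ (by linarith) (by linarith)]
      nlinarith [mul_nonneg (by linarith : (0 : ℚ) ≤ 2 * k - T - 4) (by linarith : (0 : ℚ) ≤ T + 92)]
    · rw [div_lt_div_iff₀ (by linarith) (by linarith)]
      nlinarith [mul_pos (by linarith : (0 : ℚ) < 2 * k - T - 2) (by linarith : (0 : ℚ) < T - 36)]

section Fails

variable (hq : φ.qexp ≤ -2) (hR : (2 : ℚ) ^ (φ.manBits + E + 3) ≤ φ.maxRat)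
include hq hR

/-- NON-EXCEPTIONAL CLASSES (`v = 3` or `v = 19`, law `k/(T+k)`), `p ≥ 8`: the first-regime value
`k/(T+k)` is STRICTLY below `W_φ(j₀ + k)` for every `k` with `2k ≥ T + 10`.
[cell, gemm.tex Prop. p:level2T] -/
theorem firstRegime_fails_of_level2T (hm : 7 ≤ φ.manBits) {j0 A B v k : ℕ}
    (hA : ((A : ℕ) : ℚ) / 4 ∈ piE2M1) (hB : ((B : ℕ) : ℚ) / 4 ∈ piE2M1)
    (hT : 144 * j0 + 9 < 2 ^ (φ.manBits + 1)) (hj0 : 1 ≤ j0)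
    (hV : A + B + 144 * j0 = 2 ^ (φ.manBits + 1) + v) (hv : v = 3 ∨ v = 19)
    (hk : 2 ^ (φ.manBits + 1) + 10 ≤ 2 * k) :
    (k : ℚ) / (2 ^ (φ.manBits + 1) + k) < worstRelErrE2M1 φ (j0 + k) := by
  have hT256 : 256 ≤ 2 ^ (φ.manBits + 1) :=
    le_trans (by norm_num) (Nat.pow_le_pow_right (by norm_num) (by omega : 8 ≤ φ.manBits + 1))
  have hvq : (v : ℚ) = 3 ∨ (v : ℚ) = 19 :=
    hv.imp (fun h => by exact_mod_cast h) (fun h => by exact_mod_cast h)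
  exact lt_of_lt_of_le
    (law_lt_level2T_ratio (T := (2 : ℚ) ^ (φ.manBits + 1)) (k := (k : ℚ)) (v := (v : ℚ))
      (by exact_mod_cast hT256) (by exact_mod_cast hk) hvq)
    (le_worstP_level2T hq hR (k := k) hA hB hT hj0 hV (by omega) (by omega) (by omega))

/-- EXCEPTIONAL CLASSES (`(b, v) = (16, 19)` or `(32, 35)`, `B_p = T + b`), `p ≥ 8`: the
first-regime closed form `max(k/(B_p+k), (k-1)/(T+k-1))` is STRICTLY below `W_φ(j₀ + k)` for every
`k` with `2k ≥ T + 4`, i.e. `k ≥ 2^(p-1) + 2` (at `k = 2^(p-1) + 1` the family's value is the closed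
form's value `1/3`). [cell, gemm.tex Prop. p:level2T] -/
theorem firstRegimeLaw_fails_of_level2T (hm : 7 ≤ φ.manBits) {j0 A B b v k : ℕ}
    (hA : ((A : ℕ) : ℚ) / 4 ∈ piE2M1) (hB : ((B : ℕ) : ℚ) / 4 ∈ piE2M1)
    (hT : 144 * j0 + 9 < 2 ^ (φ.manBits + 1)) (hj0 : 1 ≤ j0)
    (hV : A + B + 144 * j0 = 2 ^ (φ.manBits + 1) + v) (hbv : (b = 16 ∧ v = 19) ∨ (b = 32 ∧ v = 35))
    (hk : 2 ^ (φ.manBits + 1) + 4 ≤ 2 * k) :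
    max ((k : ℚ) / (2 ^ (φ.manBits + 1) + b + k)) (((k : ℚ) - 1) / (2 ^ (φ.manBits + 1) + k - 1))
      < worstRelErrE2M1 φ (j0 + k) := by
  have hT256 : 256 ≤ 2 ^ (φ.manBits + 1) :=
    le_trans (by norm_num) (Nat.pow_le_pow_right (by norm_num) (by omega : 8 ≤ φ.manBits + 1))
  have hbvq : ((b : ℚ) = 16 ∧ (v : ℚ) = 19) ∨ ((b : ℚ) = 32 ∧ (v : ℚ) = 35) := by
    rcases hbv with ⟨h1, h2⟩ | ⟨h1, h2⟩
    · exact Or.inl ⟨by exact_mod_cast h1, by exact_mod_cast h2⟩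
    · exact Or.inr ⟨by exact_mod_cast h1, by exact_mod_cast h2⟩
  exact lt_of_lt_of_le
    (lawMax_lt_level2T_ratio (T := (2 : ℚ) ^ (φ.manBits + 1)) (k := (k : ℚ)) (b := (b : ℚ))
      (v := (v : ℚ)) (by exact_mod_cast hT256) (by exact_mod_cast hk) hbvq)
    (le_worstP_level2T hq hR (k := k) hA hB hT hj0 hV (by omega) (by omega) (by omega))

/-! ### The six residue classes of `p (mod 6)`: the first regime ends at `k = 2^(p-1)` -/

/-- `p ≡ 1 (mod 6)` (`T = 144 j₀ + 128`, e.g. `p = 13, 19, …`; word `¾, 36, 36^{×j₀}, ¾…, ½, -½…`,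
`v = 19`): `max(k/(T+16+k), (k-1)/(T+k-1)) < W_φ(j₀+k)` for every `k ≥ 2^(p-1) + 2` — the exact
law of `worstP_firstRegimeLaw_one` (`k ≤ 2^(p-1) - 2^8`) does not extend past `2^(p-1) + 1`.
[cell, gemm.tex Prop. p:level2T] -/
theorem firstRegimeLaw_one_fails (hm : 7 ≤ φ.manBits) {j0 : ℕ}
    (hj0 : 144 * j0 + 128 = 2 ^ (φ.manBits + 1)) {k : ℕ} (hk : 2 ^ (φ.manBits + 1) + 4 ≤ 2 * k) :
    max ((k : ℚ) / (2 ^ (φ.manBits + 1) + 16 + k)) (((k : ℚ) - 1) / (2 ^ (φ.manBits + 1) + k - 1))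
      < worstRelErrE2M1 φ (j0 + k) := by
  have hT256 : 256 ≤ 2 ^ (φ.manBits + 1) :=
    le_trans (by norm_num) (Nat.pow_le_pow_right (by norm_num) (by omega : 8 ≤ φ.manBits + 1))
  have h := firstRegimeLaw_fails_of_level2T hq hR hm (j0 := j0) (A := 3) (B := 144) (b := 16)
    (v := 19) (k := k) (by norm_num [piE2M1]) (by norm_num [piE2M1]) (by omega) (by omega)
    (by omega) (Or.inl ⟨rfl, rfl⟩) hk
  simpa only [Nat.cast_ofNat] using h

/-- `p ≡ 2 (mod 6)` (`T = 144 j₀ + 112`, e.g. `p = 8, 14, 20, …`; word `¾, 36, 36^{×j₀}, ¾…, ½,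
-½…`, `v = 35`): `max(k/(T+32+k), (k-1)/(T+k-1)) < W_φ(j₀+k)` for every `k ≥ 2^(p-1) + 2`
(bfloat16: `worstP_BFloat16_law_fails`, `n = k + 2 ≥ 132`). [cell, gemm.tex Prop. p:level2T] -/
theorem firstRegimeLaw_two_fails (hm : 7 ≤ φ.manBits) {j0 : ℕ}
    (hj0 : 144 * j0 + 112 = 2 ^ (φ.manBits + 1)) {k : ℕ} (hk : 2 ^ (φ.manBits + 1) + 4 ≤ 2 * k) :
    max ((k : ℚ) / (2 ^ (φ.manBits + 1) + 32 + k)) (((k : ℚ) - 1) / (2 ^ (φ.manBits + 1) + k - 1))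
      < worstRelErrE2M1 φ (j0 + k) := by
  have hT256 : 256 ≤ 2 ^ (φ.manBits + 1) :=
    le_trans (by norm_num) (Nat.pow_le_pow_right (by norm_num) (by omega : 8 ≤ φ.manBits + 1))
  have h := firstRegimeLaw_fails_of_level2T hq hR hm (j0 := j0) (A := 3) (B := 144) (b := 32)
    (v := 35) (k := k) (by norm_num [piE2M1]) (by norm_num [piE2M1]) (by omega) (by omega)
    (by omega) (Or.inr ⟨rfl, rfl⟩) hk
  simpa only [Nat.cast_ofNat] using h

/-- `p ≡ 0 (mod 6)` (`T = 144 j₀ + 64`, e.g. `p = 12, 18, 24`; word `¾, 16, 36^{×j₀}, …`, `v = 3`):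
`k/(T+k) < W_φ(j₀+k)` for every `k ≥ 2^(p-1) + 5`. [cell, gemm.tex Prop. p:level2T] -/
theorem firstRegime_fails_zero (hm : 7 ≤ φ.manBits) {j0 : ℕ}
    (hj0 : 144 * j0 + 64 = 2 ^ (φ.manBits + 1)) {k : ℕ} (hk : 2 ^ (φ.manBits + 1) + 10 ≤ 2 * k) :
    (k : ℚ) / (2 ^ (φ.manBits + 1) + k) < worstRelErrE2M1 φ (j0 + k) := by
  have hT256 : 256 ≤ 2 ^ (φ.manBits + 1) :=
    le_trans (by norm_num) (Nat.pow_le_pow_right (by norm_num) (by omega : 8 ≤ φ.manBits + 1))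
  exact firstRegime_fails_of_level2T hq hR hm (A := 3) (B := 64) (v := 3) (k := k)
    (by norm_num [piE2M1]) (by norm_num [piE2M1]) (by omega) (by omega) (by omega) (Or.inl rfl) hk

/-- `p ≡ 3 (mod 6)` (`T = 144 j₀ + 80`, e.g. `p = 9, 15, 21`; word `¾, 24, 36^{×j₀}, …`, `v = 19`):
`k/(T+k) < W_φ(j₀+k)` for every `k ≥ 2^(p-1) + 5`. [cell, gemm.tex Prop. p:level2T] -/
theorem firstRegime_fails_three (hm : 7 ≤ φ.manBits) {j0 : ℕ}
    (hj0 : 144 * j0 + 80 = 2 ^ (φ.manBits + 1)) {k : ℕ} (hk : 2 ^ (φ.manBits + 1) + 10 ≤ 2 * k) :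
    (k : ℚ) / (2 ^ (φ.manBits + 1) + k) < worstRelErrE2M1 φ (j0 + k) := by
  have hT256 : 256 ≤ 2 ^ (φ.manBits + 1) :=
    le_trans (by norm_num) (Nat.pow_le_pow_right (by norm_num) (by omega : 8 ≤ φ.manBits + 1))
  exact firstRegime_fails_of_level2T hq hR hm (A := 3) (B := 96) (v := 19) (k := k)
    (by norm_num [piE2M1]) (by norm_num [piE2M1]) (by omega) (by omega) (by omega) (Or.inr rfl) hk

/-- `p ≡ 4 (mod 6)` (`T = 144 j₀ + 16`, e.g. `p = 10, 16, 22`; word `¾, 4, 36^{×j₀}, …`, `v = 3`):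
`k/(T+k) < W_φ(j₀+k)` for every `k ≥ 2^(p-1) + 5`. [cell, gemm.tex Prop. p:level2T] -/
theorem firstRegime_fails_four (hm : 7 ≤ φ.manBits) {j0 : ℕ}
    (hj0 : 144 * j0 + 16 = 2 ^ (φ.manBits + 1)) {k : ℕ} (hk : 2 ^ (φ.manBits + 1) + 10 ≤ 2 * k) :
    (k : ℚ) / (2 ^ (φ.manBits + 1) + k) < worstRelErrE2M1 φ (j0 + k) := by
  have hT256 : 256 ≤ 2 ^ (φ.manBits + 1) :=
    le_trans (by norm_num) (Nat.pow_le_pow_right (by norm_num) (by omega : 8 ≤ φ.manBits + 1))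
  exact firstRegime_fails_of_level2T hq hR hm (A := 3) (B := 16) (v := 3) (k := k)
    (by norm_num [piE2M1]) (by norm_num [piE2M1]) (by omega) (by omega) (by omega) (Or.inl rfl) hk

/-- `p ≡ 5 (mod 6)` (`T = 144 j₀ + 32`, e.g. `p = 11, 17, 23`; word `¾, 8, 36^{×j₀}, …`, `v = 3`):
`k/(T+k) < W_φ(j₀+k)` for every `k ≥ 2^(p-1) + 5` (binary16: `worstP_Binary16_law_fails`).
[cell, gemm.tex Prop. p:level2T] -/
theorem firstRegime_fails_five (hm : 7 ≤ φ.manBits) {j0 : ℕ}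
    (hj0 : 144 * j0 + 32 = 2 ^ (φ.manBits + 1)) {k : ℕ} (hk : 2 ^ (φ.manBits + 1) + 10 ≤ 2 * k) :
    (k : ℚ) / (2 ^ (φ.manBits + 1) + k) < worstRelErrE2M1 φ (j0 + k) := by
  have hT256 : 256 ≤ 2 ^ (φ.manBits + 1) :=
    le_trans (by norm_num) (Nat.pow_le_pow_right (by norm_num) (by omega : 8 ≤ φ.manBits + 1))
  exact firstRegime_fails_of_level2T hq hR hm (A := 3) (B := 32) (v := 3) (k := k)
    (by norm_num [piE2M1]) (by norm_num [piE2M1]) (by omega) (by omega) (by omega) (Or.inl rfl) hk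

end Fails

/-! ### bfloat16 (`p = 8`, `T = 256 = 144 + 112`, `v = 35`, `j₀ = 1`, `c = 56`) -/

/-- THE LEVEL-`2T` FAMILY INTO bfloat16 is the level-7 family (a) of file LIII
(`¾, 36, 36, ¾^{×56}, ½, -½, …`): `(2n - 61)/(2n + 341) ≤ W_8(n)` for every `n ≥ 60` (index
`n - 1`); consistency with `TieChain.bf16_l7a_ratio`. [cell, gemm.tex Prop. p:sandwich (i)] -/
theorem le_worstP_BFloat16_level2T {n : ℕ} (hn : 60 ≤ n) :
    ((2 * n : ℚ) - 61) / (2 * n + 341) ≤ worstRelErrE2M1 Format.BFloat16 (n - 1) := by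
  have hq : Format.BFloat16.qexp ≤ -2 := by decide
  have hR : (2 : ℚ) ^ (Format.BFloat16.manBits + 7 + 3) ≤ Format.BFloat16.maxRat := by
    rw [Format.BFloat16_maxRat.1, show Format.BFloat16.manBits = 7 from rfl]; norm_num
  obtain ⟨k, rfl⟩ : ∃ k, n = k + 2 := ⟨n - 2, by omega⟩
  have w := le_worstP_level2T (E := 7) hq hR (j0 := 1) (A := 3) (B := 144) (v := 35) (k := k)
    (by norm_num [piE2M1]) (by norm_num [piE2M1]) (by decide) le_rfl (by decide) (by decide)
    (by decide) (by rw [show Format.BFloat16.manBits + 1 = 8 from rfl]; norm_num; omega)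
  rw [show Format.BFloat16.manBits + 1 = 8 from rfl] at w
  rw [show k + 2 - 1 = 1 + k by omega]
  refine le_trans (le_of_eq ?_) w
  have hk : (0 : ℚ) ≤ k := by positivity
  push_cast
  rw [div_eq_div_iff (by linarith) (by norm_num; linarith)]
  ring

/-! ### binary16 (`p = 11 ≡ 5 (mod 6)`, `T = 2048 = 144·14 + 32`, `v = 3`, `j₀ = 14`, `c = 512`) -/

/-- FP4 PRODUCTS INTO binary16 BEYOND THE FIRST REGIME: `(2n - 543)/(2n + 2531) ≤ W_11(n)` for
every `n ≥ 529` (index `n - 1`; the word `¾, 8, 36^{×14}, ¾^{×512}, ½, (-½)^{×(n-530)}`, accumulator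
`2T + 8 = 4104` quarter units `= 1026` forever). [cell, gemm.tex Prop. p:level2T / p:fp16] -/
theorem le_worstP_Binary16_level2T {n : ℕ} (hn : 529 ≤ n) :
    ((2 * n : ℚ) - 543) / (2 * n + 2531) ≤ worstRelErrE2M1 Format.Binary16 (n - 1) := by
  have hq : Format.Binary16.qexp ≤ -2 := by decide
  have hR : (2 : ℚ) ^ (Format.Binary16.manBits + 1 + 3) ≤ Format.Binary16.maxRat := by
    rw [Format.Binary16_maxRat.1, show Format.Binary16.manBits = 10 from rfl]; norm_num
  obtain ⟨k, rfl⟩ : ∃ k, n = k + 15 := ⟨n - 15, by omega⟩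
  have w := le_worstP_level2T (E := 1) hq hR (j0 := 14) (A := 3) (B := 32) (v := 3) (k := k)
    (by norm_num [piE2M1]) (by norm_num [piE2M1]) (by decide) (by norm_num) (by decide) (by decide)
    (by decide) (by rw [show Format.Binary16.manBits + 1 = 11 from rfl]; norm_num; omega)
  rw [show Format.Binary16.manBits + 1 = 11 from rfl] at w
  rw [show k + 15 - 1 = 14 + k by omega]
  refine le_trans (le_of_eq ?_) w
  have hk : (0 : ℚ) ≤ k := by positivity
  push_cast
  rw [div_eq_div_iff (by linarith) (by norm_num; linarith)]
  ring

/-- THE CERTIFIED ROW `n = 1200` IN THE KERNEL (lower side): `1857/4931 ≤ W_11(1200)`; the certified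
table value (`GEMM-BOUNDS.md` §4, two implementations) is `W_11(1200) = 1857/4931` EXACTLY, attained
by this word — equality is the certificate's, not a kernel theorem. [cell, gemm.tex Prop. p:level2T] -/
theorem le_worstP_Binary16_1200 : (1857 : ℚ) / 4931 ≤ worstRelErrE2M1 Format.Binary16 1199 := by
  have h := le_worstP_Binary16_level2T (n := 1200) (by norm_num)
  norm_num at h
  exact h

/-- Prop. p:fp16's CLOSED FORM FAILS FROM `n = 1044` ON: `(n - 15)/(2033 + n) < W_11(n)` for every
`n ≥ 1044` (kernel-exact `W_11(n) = (n-15)/(2033+n)` for `16 ≤ n ≤ 1039`, `worstP_Binary16_law`;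
the four lengths `1040 ≤ n ≤ 1043` are decided by neither theorem). [cell, gemm.tex Prop. p:fp16] -/
theorem worstP_Binary16_law_fails {n : ℕ} (hn : 1044 ≤ n) :
    ((n : ℚ) - 15) / (2033 + n) < worstRelErrE2M1 Format.Binary16 (n - 1) := by
  refine lt_of_lt_of_le ?_ (le_worstP_Binary16_level2T (by omega))
  have hnq : (1044 : ℚ) ≤ n := by exact_mod_cast hn
  rw [div_lt_div_iff₀ (by linarith) (by linarith)]
  nlinarith

end Summit.Ventures.CertifiedArithmetic.LowPrec.Gemm
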